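/-
Copyright (c) 2026 the pub-hodgecm-mathlib formalisation cell (harness21).  Prover seat hodgecm-mathlib-LH7-p04 (g8), E3a pen (dealer LH2-plan (g1) 2026-09-02 17:22:05Z; HANDOFF-E3 of
LH3-p04 (g7)): layer (L1) of E3a — the per-ball identity from the readings (CENSUS-E3a v1 748a715383396d15 §2).
-/
import Literature.NumberTheory.Rogawski1990.ArchEPAssemblyCore          -- ★ E3-CORE p852223 (LH3-p04 (g7)): `stableSumG_eq_inv_pow_mul_of_readings`; brings ★ `stableSumG_eq_archRG_mul_sum_div_of_mem_regG`, `stableSumG`, `partnerPerms`, `slotPerm`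
import Literature.NumberTheory.Rogawski1990.ArchHCOrbitalFamilyGExt     -- ★ `orbFamGExt`, `orbFamGExt_of_not_admissible`
import HarnessLib

/-!
# EP assembly, layer (L1): the per-ball identity `SS_β(f) = 3^{-#D} · SS_α(a″)` on EVERY regular chart from the readings

Topic `NumberTheory/Rogawski1990`; namespace `Literature.NumberTheory.Rogawski1990`.  THEOREMS ONLY (no definition, no instance, no notation, no named fact, no `sorry`); kernel lane
`--supports stmt-HodgeConjecture-24833`.  Cell `pub/hodgecm-mathlib` (D-0151), crux H413; HCML «GO 500» road N8-INNER ROAD B «EP road» (owner LH2-plan (g1)), brick E3 «EP ASSEMBLY = H-S4′»: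
★ E3b p852221 (class partition) → **E3a (this file's layers (L1)–(L2))** → ★ E3-SUM (`stableSurjG_of_ballTransfer`) → E3 head.  HONEST LABEL: count-neutral; HC_CM is proved only modulo
the 7 printed citations (2 remaining: hLiu418 = stmt-HodgeConjecture-24832, h413 = stmt-HodgeConjecture-24833) until rung 0 closes.

LAYER (L1), PURE LOGIC over ★ E3-CORE.  For ONE ball's pair of test functions — `f` on `U(diag β)_∞` (the tensor `f_J`) and `a″` on `U(diag α)_∞` (the localised `(ρ_J ∘ cl) · a′`) — and the
definite block `D` (`hD : w ∈ D ↔ w ∉ splitChartPlaces L α`):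
* JUNK LABELS (`S` meets `D`): the `α`-member `orbFamGExt L α ν′ a″ S` is identically `0` (★ `orbFamGExt_of_not_admissible`: `S ⊄ splitChartPlaces α`), so `SS_α(a″) S c = 0`; the hypothesis
  `hjunk` says the `β`-member vanishes at the partner points of `c` (the (s2) junk-label slice: the SPLIT clause of the generator at `w₀ ∈ S ∩ D`), so `SS_β(f) S c = 0`
  (★ `stableSumG_eq_archRG_mul_sum_div_of_mem_regG`).
* LABELS OFF `D`: the hypothesis `hread` supplies the four CORE readings (tensor reading `hβ`, definite closed form `hα`, guarded block transport `hIT`, weighted compact clauses `hgen`) of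
  ★ `stableSumG_eq_inv_pow_mul_of_readings` with `p := (· ∈ D)`, `F_β := orbFamGExt L β νβ f`, `F_α := orbFamGExt L α ν′ a″`, whence `SS_β(f) S c = 3^{-#D} · SS_α(a″) S c`.
Head **`ballIdentity_of_readings`**: `∀ S c, c ∈ RegG S → stableSumG (orbFamGExt L β νβ f) S c = 3⁻¹ ^ Fintype.card {w // p w} * stableSumG (orbFamGExt L α ν′ a″) S c` (the block as
a decidable predicate `p`, exactly as ★ E3-CORE; the head takes `p := (¬ IsIndefiniteAt (slotSign L α) ·)`, so `3⁻¹ ^ card = ∏ _w ∈ univ.filter p, 3⁻¹` is H-S4′'s `κ`).  The slices that produce `hjunk`,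
`hread` (co-hands F0P2-p02 hβ, F0P3a-p02 hgen, LH3-p03 (s1)(s2), F0P3b-p01 (c1)(B3), ★ (IT)-3 p852235, ★ E2b p852207) are typed to the letters of this head (CENSUS-E3a v1 §3).

## References
* [Rogawski1990] J. D. Rogawski, *Automorphic Representations of Unitary Groups in Three Variables*, Ann. of Math. Stud. 123 (1990), §4.1 (4.1.1) p. 39; §8.2 p. 122; §14.2 (14.2.1) p. 232.
* [Shelstad1979] D. Shelstad, *Characters and inner forms of a quasi-split group over ℝ*, Compositio Math. 39 (1979), §4 pp. 22–26, Lemma 4.2 p. 23.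
-/

set_option autoImplicit false

noncomputable section

open MeasureTheory NumberField NumberField.InfinitePlace Complex Finset Equiv
open scoped Classical MatrixGroups Matrix
open Literature.NumberTheory.Automorphic Literature.NumberTheory.Automorphic.UnitaryGroup Literature.NumberTheory.Automorphic.ArchCartan

namespace Literature.NumberTheory.Rogawski1990

section Generic

variable {W : Type*} [Fintype W] [DecidableEq W]

/-- **On a junk label the `β`-side stable sum vanishes as soon as the member vanishes at the partner points** (the (s2) slice feeds this).
[cite: Shelstad1979, Lemma 4.2 p. 23] -/
theorem stableSumG_eq_zero_of_forall_partner_eq_zero (F : Finset W → (W → Fin 3 → ℝ) → ℂ) {S : Finset W} {c : W → Fin 3 → ℝ} (hc : c ∈ RegG S)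
    (h0 : ∀ ρ ∈ partnerPerms S, F S (slotPerm ρ c) = 0) :
    stableSumG F S c = 0 := by
  rw [stableSumG_eq_archRG_mul_sum_div_of_mem_regG _ hc, Finset.sum_eq_zero fun ρ hρ => by rw [h0 ρ hρ, zero_div], mul_zero]

end Generic

section BallIdentity

variable (L : Type) [Field L] [NumberField L] [IsCMField L] (α β : Fin 3 → L)
  [MeasurableSpace ↥(arch (↥(maximalRealSubfield L)) L (IsCMField.complexConj L) 3 (Matrix.diagonal α))] [BorelSpace ↥(arch (↥(maximalRealSubfield L)) L (IsCMField.complexConj L) 3 (Matrix.diagonal α))]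
  [MeasurableSpace ↥(arch (↥(maximalRealSubfield L)) L (IsCMField.complexConj L) 3 (Matrix.diagonal β))] [BorelSpace ↥(arch (↥(maximalRealSubfield L)) L (IsCMField.complexConj L) 3 (Matrix.diagonal β))]
  (ν' : Measure ↥(arch (↥(maximalRealSubfield L)) L (IsCMField.complexConj L) 3 (Matrix.diagonal α))) [IsFiniteMeasureOnCompacts ν'] [ν'.IsMulRightInvariant]
  (νβ : Measure ↥(arch (↥(maximalRealSubfield L)) L (IsCMField.complexConj L) 3 (Matrix.diagonal β))) [IsFiniteMeasureOnCompacts νβ] [νβ.IsMulRightInvariant]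

/-- **On a junk label the `α`-side stable sum vanishes**: if `S` contains a definite place (`w₀ ∈ S`, `w₀ ∉ splitChartPlaces L α`) then `stableSumG (orbFamGExt L α ν′ a″) S c = 0` on
`RegG S` (★ `orbFamGExt_of_not_admissible`). [cite: Shelstad1979, §4 p. 22] -/
theorem stableSumG_orbFamGExt_eq_zero_of_not_admissible (a'' : ↥(arch (↥(maximalRealSubfield L)) L (IsCMField.complexConj L) 3 (Matrix.diagonal α)) → ℂ)
    {S : Finset {w : InfinitePlace L // IsComplex w}} (hS : ¬ ∀ w, w ∈ S → w ∈ splitChartPlaces L α)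
    {c : {w : InfinitePlace L // IsComplex w} → Fin 3 → ℝ} (hc : c ∈ RegG S) :
    stableSumG (orbFamGExt L α ν' a'') S c = 0 := by
  rw [stableSumG_eq_archRG_mul_sum_div_of_mem_regG _ hc, orbFamGExt_of_not_admissible L α ν' a'' S hS]
  simp only [zero_div, Finset.sum_const_zero, mul_zero]

/-- **(L1) THE PER-BALL IDENTITY FROM THE READINGS.**  For one ball's pair `(f, a″)` and the definite block `p` («`w` is `α`-definite», `hp : p w ↔ w ∉ splitChartPlaces L α`; the head
instantiates `p := (¬ IsIndefiniteAt (slotSign L α) ·)` or `(· ∈ D)`): if on every junk label (`S` meets `p`) the `β`-member vanishes at the partner points (`hjunk`), and on every label off `p`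
the four readings of ★ E3-CORE exist (`hread`: tensor reading `hβ`, definite closed form `hα`, guarded block transport `hIT`, weighted compact clauses `hgen`, for `F_β := orbFamGExt L β νβ f`,
`F_α := orbFamGExt L α ν′ a″` — CORE's letters VERBATIM), then **`stableSumG (orbFamGExt L β νβ f) S c = 3⁻¹ ^ #p · stableSumG (orbFamGExt L α ν′ a″) S c`** for every `S` and every
`c ∈ RegG S`. [cite: Rogawski1990, §4.1 (4.1.1) p. 39; §14.2 (14.2.1) p. 232] [cite: Shelstad1979, Lemma 4.2 p. 23] -/
theorem ballIdentity_of_readings (p : {w : InfinitePlace L // IsComplex w} → Prop) [DecidablePred p] (hp : ∀ w, p w ↔ w ∉ splitChartPlaces L α)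
    (f : ↥(arch (↥(maximalRealSubfield L)) L (IsCMField.complexConj L) 3 (Matrix.diagonal β)) → ℂ)
    (a'' : ↥(arch (↥(maximalRealSubfield L)) L (IsCMField.complexConj L) 3 (Matrix.diagonal α)) → ℂ)
    (hjunk : ∀ (S : Finset {w : InfinitePlace L // IsComplex w}) (c : {w : InfinitePlace L // IsComplex w} → Fin 3 → ℝ), c ∈ RegG S →
      (∃ w ∈ S, p w) → ∀ ρ ∈ partnerPerms S, orbFamGExt L β νβ f S (slotPerm ρ c) = 0)
    (hread : ∀ (S : Finset {w : InfinitePlace L // IsComplex w}) (c : {w : InfinitePlace L // IsComplex w} → Fin 3 → ℝ), c ∈ RegG S →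
      (∀ w, p w → w ∉ S) →
      ∃ (m : {w // p w} → ℂ) (g : {w // p w} → (Fin 3 → ℝ) → ℂ) (r : {w // p w} → ℂ)
        (Rβ Rα : ({w : {w : InfinitePlace L // IsComplex w} // ¬ p w} → Equiv.Perm (Fin 3)) → ℂ),
        (∀ ρ ∈ partnerPerms S, orbFamGExt L β νβ f S (slotPerm ρ c) / archRG S (slotPerm ρ c) =
          (∏ w : {w // p w}, m w * g w (c w.1 ∘ ⇑(ρ w.1))) * Rβ fun w : {w : {w : InfinitePlace L // IsComplex w} // ¬ p w} => ρ w.1) ∧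
        (∑ ρ ∈ partnerPerms S, orbFamGExt L α ν' a'' S (slotPerm ρ c) / archRG S (slotPerm ρ c) =
          (∏ w : {w // p w}, r w) * (6 : ℂ) ^ Fintype.card {w // p w} * ∑ ρ₂ ∈ partnerPerms (S.subtype fun w => ¬ p w), Rα ρ₂) ∧
        ((∏ w : {w // p w}, r w) ≠ 0 → ∀ ρ₂ ∈ partnerPerms (S.subtype fun w => ¬ p w), Rβ ρ₂ = Rα ρ₂) ∧
        (∀ w : {w // p w}, m w * ∑ σ : Equiv.Perm (Fin 3), g w (c w.1 ∘ ⇑σ) = 2 * r w))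
    (S : Finset {w : InfinitePlace L // IsComplex w}) (c : {w : InfinitePlace L // IsComplex w} → Fin 3 → ℝ) (hc : c ∈ RegG S) :
    stableSumG (orbFamGExt L β νβ f) S c = ((3 : ℂ)⁻¹) ^ Fintype.card {w // p w} * stableSumG (orbFamGExt L α ν' a'') S c := by
  by_cases hSD : ∃ w ∈ S, p w
  · -- a junk label: both sides vanish
    obtain ⟨w₀, hw₀S, hw₀D⟩ := hSD
    have hnadm : ¬ ∀ w, w ∈ S → w ∈ splitChartPlaces L α := fun h => (hp w₀).1 hw₀D (h w₀ hw₀S)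
    rw [stableSumG_orbFamGExt_eq_zero_of_not_admissible L α ν' a'' hnadm hc, mul_zero,
      stableSumG_eq_zero_of_forall_partner_eq_zero (orbFamGExt L β νβ f) hc (hjunk S c hc ⟨w₀, hw₀S, hw₀D⟩)]
  · -- a label off the block: the core identity
    have hS : ∀ w, p w → w ∉ S := fun w hwD hwS => hSD ⟨w, hwS, hwD⟩
    obtain ⟨m, g, r, Rβ, Rα, hβ, hα, hIT, hgen⟩ := hread S c hc hS
    exact stableSumG_eq_inv_pow_mul_of_readings p hS hc (orbFamGExt L β νβ f) (orbFamGExt L α ν' a'') m g r Rβ Rα hβ hα hIT hgen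

end BallIdentity

end Literature.NumberTheory.Rogawski1990
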